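import Summits.QuantumFields.BalabanUV.T4Continuum.Spine.NE1p.DressedRebornMuPart

/-!
# T⁴ programme, spine estimate NE1′ (node O3b/H2) — THE LINEAR RESPONSE OF THE RE-BORN PART: the source DERIVATIVE of what a family's
# content regenerates, `‖∂_μ (E(μ,1) − E(μ,0))‖ ≤ 2·((2M∕ε)·σ)∕(μ₁ − μ₀)` on the window `‖μ‖ ≤ μ₀ < μ₁` — the owner's Allowance §2
# `muDeriv_norm_le_of_window` applied to the content-sourced part, whose s-Schwarz bound `(2M∕ε)·σ` (§3 `regen_le_of_slack`) holds at
# EVERY source on the disc; fed with (B1a) discharged by S33 §2's parametric END at `P := ℂ × ℂ` (exp-linear families; (2.14)-cores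
# along the bi-pencil)

Cell `pub-balaban`, sub-cell `t4`, BINDER-OWNERS row NE1′; NE1′ formalisation crew, unit `b2b-balaban-t4-ne1p-formalise-leaf-03`
(LEAF PROVER 03, generation 14); crew row S⟨next⟩ of `t4/formal/NE1p/LEAVES.md` (own-lineage follower of S56 `DressedRebornMuPart` (p239964) —
its DERIVATIVE twin, as N0j's `muDeriv_locE_le` is the derivative twin of `muPart_locE_le`).  ADDITIVE — imports S56
`Spine/NE1p/DressedRebornMuPart` ONLY (→ S33 → N0j → `DressedSmallFieldAllowance`; N0r∕N0q∕N0p for the cores' letters); THEOREMS ONLY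
(0 def, 0 `def … : Prop`, 0 cite); nothing restated.

WHY THIS FILE.  S56 typed the SIZE form of the dressed (w5) END — the mixed difference over `{0, μ} × {0, 1}`, `≤ (4Mμ₀∕(μ₁ε))·σ`.  The
owner's allowance arithmetic (`DressedSmallFieldAllowance` §2, C-t4r2-340 (n2) «third Cauchy radius») consumes the μ-DERIVATIVE form of a
dressed quantity on the strict sub-window `‖μ‖ ≤ μ₀ < μ₁` (`muDeriv_norm_le_of_window`: `‖E′(μ)‖ ≤ 2M∕(μ₁ − μ₀)`), and N0j ∕ S33 ∕ S37 ∕ S46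
∕ S50 carry that RESPONSE face for the FULL output (`muDeriv_locE_le…`).  For the CONTENT-SOURCED part `E(μ,1) − E(μ,0)` of the output —
what a re-born family contributes — no response face exists (`grep -n "deriv" Spine/NE1p/DressedRebornMuPart.lean` = ∅; the Allowance's
`muDeriv_norm_le_of_window` has appliers N0j §2 and `DressedSmallFieldSeries` only).  Here:
* §1 [folklore] `rebornMuDeriv_le_of_bidisc`: for `E : ℂ × ℂ → F` complex differentiable on `ball 0 μ₁ ×ˢ ball 0 (ε∕σ)` and bounded by
  `M` there, `0 < σ < ε`, `μ₀ < μ₁`, `‖μ‖ ≤ μ₀`: `‖deriv (m ↦ E(m,1) − E(m,0)) μ‖ ≤ 2·((2M∕ε)·σ)∕(μ₁ − μ₀)` — Allowance §3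
  `regen_le_of_slack` at EVERY source `m` of the disc bounds the μ-holomorphic function `G(m) = E(m,1) − E(m,0)` by `(2M∕ε)·σ`, and Allowance
  §2 `muDeriv_norm_le_of_window` on `G` gives the claim; the constant is LINEAR in the content size `σ` with the window quotient
  `1∕(μ₁ − μ₀)` DISPLAYED.
* §2 `rebornMuDeriv_locE_le_of_expLinear` (kernel; S33 §2 `analytic_and_bounded_locE_param_of_expLinear` EXACTLY ONCE at `P := ℂ × ℂ`,
  then §1): abstract table map `hc : ℂ × ℂ → Hist`.
* §3 `rebornMuDeriv_locE_le_of_coresAt_bipencil_mass` (kernel; S33 §2 EXACTLY ONCE via `termHistExpLinear_termAt` along the bi-pencil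
  `h₀ + μ • u + s • v`, class membership and read-out growth by N0p's `pencil_mem_ballClass` ∕ `norm_pencil_le` at the base `h₀ + μ • u`,
  (B3) via `norm_integral_coreDensity_le` termwise — S56 §3's plumbing VERBATIM; then §1): binders = S56 §3's PLUS the window
  [`μ₀`, `h01`, `hμ : ‖μ‖ ≤ μ₀`] (MINUS `hμ : μ ∈ ball 0 μ₁`); conclusion
  `‖deriv (m ↦ E[act(m,1)](X₀) − E[act(m,0)](X₀)) μ‖ ≤ 2·((2M∕ε)·‖v‖)∕(μ₁ − μ₀)`, `M = e·ν·c₁·K₀²·A·e^{−r₁ d(X₀)}`.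

WHAT STAYS DISPLAYED (binders, by name; NOTHING instantiated on Bałaban's densities): as in S56 — `hroom`; the Gaussian letter blocks; `hO`∕`hH`
(room for BOTH directions); (B1b)'s residue `terms`∕`emb`∕`hscale`; the clause SHAPES; (B3) = `hM3` (G-ne9p2-5, UNPRINTED, shared with NE9, a
BINDER); the source radius `μ₁`, window `μ₀` and the content's room `ε` with `‖v‖ < ε`.  `4M∕(ε(μ₁ − μ₀))` per unit content is a READING of the
response of the dressed (w5) constant along the bi-pencil (the (w5)∕allowance constants are the cell's readings — owner g31 l.21941 ∕
l.22720) — (B1a) discharged at the cores, (w5)∕(w6) NOT discharged on Bałaban's densities.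

HONEST FRAMING.  §1 is textbook complex analysis by the owner's [folklore] Allowance lemmas BY NAME; §2∕§3 are by-name compositions over SHAPES
(S33's parametric END at `P := ℂ × ℂ`, (B1a) relocated onto row NE5's exp-linear FORMAT hypothesis — identification with Bałaban's (2.14) =
the substrate's DISPLAYED reading, NOT claimed); (B1b) ∕ (B3) ∕ (B5) NOT discharged; 0 binders instantiated on Bałaban's densities; no new
inequality beyond [folklore] Schwarz∕Cauchy; no wall item of NE1′ or NE5 moves; the NE1′ wall wording of record v1.8 (T4-DAG v48) — words,
not kind — does NOT move; R-t4r2-Q2 NOT met; ABSOLUTE RULE honoured ([folklore] kernel lemmas only; no numeral of print; no disputed step of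
the audited manuscripts enters as a fact).  NE1′ ⇐ the named binders — NOT proved, NOT printed; spine PROVED 0∕9; count 9 unchanged.  Rung
(B)+1 on ONE finite four-torus — NOT infinite volume, NOT a mass gap, NOT OS on ℝ⁴, NOT Clay.  HONEST DEPENDENCY: continuum YM on T⁴ ⇐
BetaPertH ∧ nine spine estimates (0/9 proved); BetaPertH ⇐ (D1) ∧ (D4) ∧ CAP+tail; G-an2-4 gates asym, D1 and NE2/3/4.
-/

noncomputable section

namespace Summit.QuantumFields.BalabanUV.T4Continuum.NE1p.DressedRebornMuResponse

open scoped BigOperators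
open Metric Set MeasureTheory
open Literature.MathematicalPhysics.QuantumFieldTheory.Balaban1983to89
open Literature.MathematicalPhysics.QuantumFieldTheory.Balaban1983to89.T4OutputRate (Carriers)
open Literature.MathematicalPhysics.QuantumFieldTheory.Balaban1983to89.B13Resummation (locE Geometry)
open Literature.MathematicalPhysics.QuantumFieldTheory.Balaban1983to89.T4InputCauchyRateSpecies (ballClass)
open Literature.MathematicalPhysics.QuantumFieldTheory.Balaban1983to89.T4InputCauchyRateTermwise (TermHistExpLinear)
open Summit.QuantumFields.BalabanUV.T4Continuum.B13HistMeasurable (MeasPotFrame B13HistM)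
open Summit.QuantumFields.BalabanUV.T4Continuum.B13TermParamGaussianBi (BiCore)
open Summit.QuantumFields.BalabanUV.T4Continuum.NE1p.DressedSmallFieldAllowance (regen_le_of_slack muDeriv_norm_le_of_window)
open Summit.QuantumFields.BalabanUV.T4Continuum.NE1p.DressedSmallFieldOnCores (pencil_mem_ballClass norm_pencil_le)
open Summit.QuantumFields.BalabanUV.T4Continuum.NE1p.DressedSmallFieldOnCoresMass (norm_integral_coreDensity_le)
open Summit.QuantumFields.BalabanUV.T4Continuum.NE1p.DressedSmallFieldOnCoresSlot (termHistExpLinear_termAt)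
open Summit.QuantumFields.BalabanUV.T4Continuum.NE1p.DressedSourceAnalyticOnCores (analytic_and_bounded_locE_param_of_expLinear)

/-! ## §1 THE RESPONSE OF THE RE-BORN PART: Schwarz in the strength at every source, Cauchy off-centre in the source -/

section Bidisc
variable {F : Type*} [NormedAddCommGroup F] [NormedSpace ℂ F]

/-- **THE μ-DERIVATIVE OF THE CONTENT-SOURCED PART IS LINEAR IN THE CONTENT** [folklore — Schwarz then Cauchy off-centre]: for
`E : ℂ × ℂ → F` complex differentiable on `ball 0 μ₁ ×ˢ ball 0 (ε∕σ)` and bounded by `M` there, `0 < σ < ε`, `μ₀ < μ₁` and `‖μ‖ ≤ μ₀`,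
`‖deriv (m ↦ E(m,1) − E(m,0)) μ‖ ≤ 2·((2M∕ε)·σ)∕(μ₁ − μ₀)`: the owner's `regen_le_of_slack` at every source `m` of the disc bounds
`G(m) = E(m,1) − E(m,0)` by `(2M∕ε)·σ`, and `muDeriv_norm_le_of_window` on the μ-holomorphic `G` gives the claim. -/
theorem rebornMuDeriv_le_of_bidisc {E : ℂ × ℂ → F} {μ₁ μ₀ σ ε M : ℝ} (hσ : 0 < σ) (hσε : σ < ε)
    (hd : DifferentiableOn ℂ E (ball (0 : ℂ) μ₁ ×ˢ ball (0 : ℂ) (ε / σ)))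
    (hM : ∀ z ∈ ball (0 : ℂ) μ₁ ×ˢ ball (0 : ℂ) (ε / σ), ‖E z‖ ≤ M) (h01 : μ₀ < μ₁) {μ : ℂ} (hμ : ‖μ‖ ≤ μ₀) :
    ‖deriv (fun m : ℂ => E (m, 1) - E (m, 0)) μ‖ ≤ 2 * (2 * M / ε * σ) / (μ₁ - μ₀) := by
  have h1 : (1 : ℂ) ∈ ball (0 : ℂ) (ε / σ) := by
    rw [mem_ball_zero_iff, norm_one]; exact (one_lt_div hσ).2 hσε
  have h0 : (0 : ℂ) ∈ ball (0 : ℂ) (ε / σ) := mem_ball_self (div_pos (hσ.trans hσε) hσ)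
  -- the strength sections at a fixed source
  have hsec : ∀ m ∈ ball (0 : ℂ) μ₁, DifferentiableOn ℂ (fun s : ℂ => E (m, s)) (ball (0 : ℂ) (ε / σ)) := fun m hm =>
    hd.comp ((differentiableOn_const m).prodMk differentiableOn_id) fun s hs => ⟨hm, hs⟩
  have hGbound : ∀ m ∈ ball (0 : ℂ) μ₁, ‖E (m, 1) - E (m, 0)‖ ≤ 2 * M / ε * σ := fun m hm =>
    regen_le_of_slack (E := fun s : ℂ => E (m, s)) hσ hσε (hsec m hm) (fun s hs => hM (m, s) ⟨hm, hs⟩)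
  -- the source section of the content-sourced part
  have hG : DifferentiableOn ℂ (fun m : ℂ => E (m, 1) - E (m, 0)) (ball (0 : ℂ) μ₁) :=
    (hd.comp (differentiableOn_id.prodMk (differentiableOn_const (1 : ℂ))) fun m hm => ⟨hm, h1⟩).sub
      (hd.comp (differentiableOn_id.prodMk (differentiableOn_const (0 : ℂ))) fun m hm => ⟨hm, h0⟩)
  exact muDeriv_norm_le_of_window hG hGbound h01 hμ

end Bidisc

/-! ## §2 EXP-LINEAR FAMILIES ALONG AN ABSTRACT TABLE MAP OF (SOURCE, STRENGTH), (B1a) DISCHARGED -/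

section ExpLinear
variable {C : Carriers} {Op Hist : Type*} [NormedAddCommGroup Hist] [NormedSpace ℂ Hist] {ι : Type*}
  {K : ℕ → (ℕ → ℝ) → C.BgB → Set (Op × Hist)} {T : ℕ → ι → Op → Hist → C.Dom → ℂ}
  {W : Set (ℕ → ℝ)} {α : ℕ → ι → Type*} [∀ k i, MeasurableSpace (α k i)] {μm : ∀ k i, Op → C.Dom → Measure (α k i)}
  {Φ : ∀ k i, Op → C.Dom → α k i → ℂ} {Λ : ∀ k i, Op → C.Dom → α k i → (Hist →L[ℂ] ℂ)}
variable (D : LocDomainSys) {Cube : Type} [DecidableEq Cube] (G : Geometry D Cube)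

open Classical in
/-- **THE RESPONSE OF THE RE-BORN PART OF THE DRESSED OUTPUT, (B1a) DISCHARGED** (kernel; S33 §2
`analytic_and_bounded_locE_param_of_expLinear` EXACTLY ONCE at `P := ℂ × ℂ`, `S := ball 0 μ₁ ×ˢ ball 0 (ε∕σ)`, then §1 ONCE): along a table map
`hc : ℂ × ℂ → Hist` holomorphic on the bidisc keeping `(o, hc z)` in the class, for `0 < σ < ε`, `μ₀ < μ₁`, `‖μ‖ ≤ μ₀`:
`‖∂_m (E[act(m,1)](X₀) − E[act(m,0)](X₀))|_{μ}‖ ≤ 2·((2M∕ε)·σ)∕(μ₁ − μ₀)`, `M = e·ν·c₁·K₀²·A·e^{−r₁ d(X₀)}`. [folklore] -/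
theorem rebornMuDeriv_locE_le_of_expLinear (hexp : TermHistExpLinear K T W μm Φ Λ) {k : ℕ} {g : ℕ → ℝ} (hg : g ∈ W)
    {U : C.BgB} {o : Op} {hc : ℂ × ℂ → Hist} {μ₁ σ ε R₀ : ℝ} (hσ : 0 < σ) (hσε : σ < ε)
    (hcurve : DifferentiableOn ℂ hc (ball (0 : ℂ) μ₁ ×ˢ ball (0 : ℂ) (ε / σ)))
    (hK : ∀ z ∈ ball (0 : ℂ) μ₁ ×ˢ ball (0 : ℂ) (ε / σ), (o, hc z) ∈ K k g U)
    (hR : ∀ z ∈ ball (0 : ℂ) μ₁ ×ˢ ball (0 : ℂ) (ε / σ), ‖hc z‖ ≤ R₀)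
    {emb : D.Dom → C.Dom} (hscale : ∀ Z, C.scale (emb Z) = k) {terms : D.Dom → Finset ι} {act : ℂ × ℂ → D.Dom → ℂ}
    (hact : ∀ z ∈ ball (0 : ℂ) μ₁ ×ˢ ball (0 : ℂ) (ε / σ), ∀ Z, act z Z = ∑ i ∈ terms Z, T k i o (hc z) (emb Z))
    {N : D.Dom → ι → ℝ} (hN0 : ∀ Z i, 0 ≤ N Z i) (hN : ∀ Z, ∀ i ∈ terms Z, ∀ᵐ a ∂μm k i o (emb Z), ‖Λ k i o (emb Z) a‖ ≤ N Z i)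
    {A R r₁ b₅ : ℝ} {X₀ : D.Dom} (hA : 0 ≤ A) (hr₁ : 0 ≤ r₁) (hb : r₁ * 5 ≤ b₅)
    (hrate : r₁ + 2 * G.κ₀ + 2 ≤ R) (hsmall : A * Real.exp (b₅ + 1) * G.K₀ * G.ν * G.c₁ ≤ 1) (hL3 : ∀ Z, G.cubes Z ⊆ G.cubes X₀ →
      ∑ i ∈ terms Z, (∫ a, ‖Φ k i o (emb Z) a‖ ∂μm k i o (emb Z)) * Real.exp (N Z i * R₀) ≤ A * Real.exp (-(R * D.dj Z)))
    {μ₀ : ℝ} (h01 : μ₀ < μ₁) {μ : ℂ} (hμ : ‖μ‖ ≤ μ₀) :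
    ‖deriv (fun m : ℂ => locE G.ι G.cubes (act (m, 1)) (G.cubes X₀) - locE G.ι G.cubes (act (m, 0)) (G.cubes X₀)) μ‖ ≤
      2 * (2 * (Real.exp 1 * G.ν * G.c₁ * G.K₀ ^ 2 * A * Real.exp (-(r₁ * D.dj X₀))) / ε * σ) / (μ₁ - μ₀) := by
  obtain ⟨hdE, hME⟩ := analytic_and_bounded_locE_param_of_expLinear D G hexp hg (isOpen_ball.prod isOpen_ball) hcurve hK hR
    hscale hact hN0 hN hA hr₁ hb hrate hsmall hL3
  exact rebornMuDeriv_le_of_bidisc (E := fun z => locE G.ι G.cubes (act z) (G.cubes X₀)) hσ hσε hdE hME h01 hμ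

end ExpLinear

/-! ## §3 CORES WITH TERM-DEPENDENT POLYMER FAMILIES ALONG THE BI-PENCIL `h₀ + μ • u + s • v` -/

section Dep
variable {C : Carriers} {P : MeasPotFrame C} {Op : Type*} [NormedAddCommGroup Op] [NormedSpace ℂ Op] {ι : Type*}
  {𝒴 : ℕ → ι → Type*} {dom : ∀ k i, 𝒴 k i → C.Dom} {β : ℕ → ι → Type*} [∀ k i, MeasurableSpace (β k i)]
  {α : ℕ → ι → Type*} [∀ k i, NormedAddCommGroup (α k i)] [∀ k i, InnerProductSpace ℝ (α k i)]
  [∀ k i, FiniteDimensional ℝ (α k i)] [∀ k i, MeasurableSpace (α k i)] [∀ k i, BorelSpace (α k i)]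
variable (D : LocDomainSys) {Cube : Type} [DecidableEq Cube] (G : Geometry D Cube)

open Classical in
/-- **THE RESPONSE OF THE RE-BORN PART FOR CORES WITH TERM-DEPENDENT POLYMER FAMILIES, (B1a) DISCHARGED, (B3) AS A LETTER BUDGET**
(kernel; S33 §2's parametric END EXACTLY ONCE at `P := ℂ × ℂ` with `hexp := termHistExpLinear_termAt` along the BI-PENCIL
`z ↦ h₀ + z.1 • u + z.2 • v`, class membership ∕ read-out growth by N0p's `pencil_mem_ballClass` ∕ `norm_pencil_le` at the base `h₀ + z.1 • u`,
(B3) via `norm_integral_coreDensity_le` termwise — S56 §3's plumbing VERBATIM; then §1 ONCE).  Binders = S56 §3's with the source DISC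
replaced by the WINDOW: `μ₀ < μ₁`, `‖μ‖ ≤ μ₀`.  Conclusion:
`‖∂_m (E[act(m,1)](X₀) − E[act(m,0)](X₀))|_{μ}‖ ≤ 2·((2M∕ε)·‖v‖)∕(μ₁ − μ₀)`. [folklore] -/
theorem rebornMuDeriv_locE_le_of_coresAt_bipencil_mass {W : Set (ℕ → ℝ)}
    {ctr : ℕ → (ℕ → ℝ) → C.BgB → Op × B13HistM P} {ROp RHist R' : ℕ → ℝ}
    (𝔊 : ∀ k i, C.Dom → BiCore P (dom k i) Op (β k i) (α k i)) {mq bq N₀ : ℕ → ι → C.Dom → ℝ} (hroom : ∀ k, ROp k < R' k)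
    (hm : ∀ k, ∀ g ∈ W, ∀ (U : C.BgB) (X : C.Dom), C.scale X = k → ∀ i, 0 < mq k i X)
    (hN : ∀ k, ∀ g ∈ W, ∀ (U : C.BgB) (X : C.Dom), C.scale X = k → ∀ i,
      (∀ o ∈ ball (ctr k g U).1 (R' k), AEStronglyMeasurable ((𝔊 k i X).N o) (𝔊 k i X).lam) ∧
      (∀ p, DifferentiableOn ℂ (fun o => (𝔊 k i X).N o p) (ball (ctr k g U).1 (R' k))) ∧
      (∀ o ∈ ball (ctr k g U).1 (R' k), ∀ p, ‖(𝔊 k i X).N o p‖ ≤ N₀ k i X))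
    (hq : ∀ k, ∀ g ∈ W, ∀ (U : C.BgB) (X : C.Dom), C.scale X = k → ∀ i,
      (∀ o ∈ ball (ctr k g U).1 (R' k),
        AEStronglyMeasurable (Function.uncurry ((𝔊 k i X).q o)) ((𝔊 k i X).lam.prod volume)) ∧
      (∀ p v, DifferentiableOn ℂ (fun o => (𝔊 k i X).q o p v) (ball (ctr k g U).1 (R' k))) ∧
      (∀ o ∈ ball (ctr k g U).1 (R' k), ∀ p v, mq k i X * ‖v‖ ^ 2 - bq k i X ≤ ((𝔊 k i X).q o p v).re))
    {k : ℕ} {g : ℕ → ℝ} (hg : g ∈ W) {U : C.BgB} {o : Op} {h₀ u v : B13HistM P} {μ₁ ε : ℝ}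
    (hv : 0 < ‖v‖) (hvε : ‖v‖ < ε)
    (hO : ‖o - (ctr k g U).1‖ ≤ ROp k) (hH : ‖h₀ - (ctr k g U).2‖ + μ₁ * ‖u‖ + ε ≤ RHist k)
    {emb : D.Dom → C.Dom} (hscale : ∀ Z, C.scale (emb Z) = k) {terms : D.Dom → Finset ι} {act : ℂ × ℂ → D.Dom → ℂ}
    (hact : ∀ z ∈ ball (0 : ℂ) μ₁ ×ˢ ball (0 : ℂ) (ε / ‖v‖), ∀ Z,
      act z Z = ∑ i ∈ terms Z, (𝔊 k i (emb Z)).termAt o (h₀ + z.1 • u + z.2 • v))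
    {A R r₁ b₅ : ℝ} {X₀ : D.Dom} (hA : 0 ≤ A) (hr₁ : 0 ≤ r₁) (hb : r₁ * 5 ≤ b₅)
    (hrate : r₁ + 2 * G.κ₀ + 2 ≤ R) (hsmall : A * Real.exp (b₅ + 1) * G.K₀ * G.ν * G.c₁ ≤ 1) (hM3 : ∀ Z, G.cubes Z ⊆ G.cubes X₀ →
      ∑ i ∈ terms Z, (𝔊 k i (emb Z)).lam.real univ * ((𝔊 k i (emb Z)).wB * N₀ k i (emb Z) *
          Real.exp (bq k i (emb Z))) * (Real.pi / (mq k i (emb Z) / 2)) ^ (Module.finrank ℝ (α k i) / 2 : ℝ) *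
        Real.exp ((𝔊 k i (emb Z)).N₁ * (‖h₀‖ + μ₁ * ‖u‖ + ε)) ≤ A * Real.exp (-(R * D.dj Z)))
    {μ₀ : ℝ} (h01 : μ₀ < μ₁) {μ : ℂ} (hμ : ‖μ‖ ≤ μ₀) :
    ‖deriv (fun m : ℂ => locE G.ι G.cubes (act (m, 1)) (G.cubes X₀) - locE G.ι G.cubes (act (m, 0)) (G.cubes X₀)) μ‖ ≤
      2 * (2 * (Real.exp 1 * G.ν * G.c₁ * G.K₀ ^ 2 * A * Real.exp (-(r₁ * D.dj X₀))) / ε * ‖v‖) / (μ₁ - μ₀) := by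
  have ho : o ∈ ball (ctr k g U).1 (R' k) := mem_ball.2 (by rw [dist_eq_norm]; exact lt_of_le_of_lt hO (hroom k))
  have hε : ε / ‖v‖ * ‖v‖ = ε := div_mul_cancel₀ ε hv.ne'
  -- the base point `h₀ + z.1 • u` of the strength pencil stays within `μ₁‖u‖` of `h₀`
  have hbase : ∀ z ∈ ball (0 : ℂ) μ₁ ×ˢ ball (0 : ℂ) (ε / ‖v‖),
      ‖h₀ + z.1 • u - (ctr k g U).2‖ + ε / ‖v‖ * ‖v‖ ≤ RHist k := by
    intro z hz
    have h1 : ‖h₀ - (ctr k g U).2 + z.1 • u‖ ≤ ‖h₀ - (ctr k g U).2‖ + μ₁ * ‖u‖ := norm_pencil_le hz.1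
    rw [hε, show h₀ + z.1 • u - (ctr k g U).2 = h₀ - (ctr k g U).2 + z.1 • u by abel]
    linarith
  have hK : ∀ z ∈ ball (0 : ℂ) μ₁ ×ˢ ball (0 : ℂ) (ε / ‖v‖), (o, h₀ + z.1 • u + z.2 • v) ∈ ballClass ctr ROp RHist k g U :=
    fun z hz => pencil_mem_ballClass hO (hbase z hz) hz.2
  have hR : ∀ z ∈ ball (0 : ℂ) μ₁ ×ˢ ball (0 : ℂ) (ε / ‖v‖), ‖h₀ + z.1 • u + z.2 • v‖ ≤ ‖h₀‖ + μ₁ * ‖u‖ + ε := by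
    intro z hz
    have h1 : ‖h₀ + z.1 • u‖ ≤ ‖h₀‖ + μ₁ * ‖u‖ := norm_pencil_le hz.1
    have h2 : ‖h₀ + z.1 • u + z.2 • v‖ ≤ ‖h₀ + z.1 • u‖ + ε / ‖v‖ * ‖v‖ := norm_pencil_le hz.2
    rw [hε] at h2
    linarith
  have hcurve : DifferentiableOn ℂ (fun z : ℂ × ℂ => h₀ + z.1 • u + z.2 • v) (ball (0 : ℂ) μ₁ ×ˢ ball (0 : ℂ) (ε / ‖v‖)) :=
    (((differentiable_const h₀).add (differentiable_fst.smul_const u)).add (differentiable_snd.smul_const v)).differentiableOn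
  have hjoint : DifferentiableOn ℂ (fun z => locE G.ι G.cubes (act z) (G.cubes X₀)) (ball (0 : ℂ) μ₁ ×ˢ ball (0 : ℂ) (ε / ‖v‖)) ∧
      ∀ z ∈ ball (0 : ℂ) μ₁ ×ˢ ball (0 : ℂ) (ε / ‖v‖), ‖locE G.ι G.cubes (act z) (G.cubes X₀)‖ ≤
        Real.exp 1 * G.ν * G.c₁ * G.K₀ ^ 2 * A * Real.exp (-(r₁ * D.dj X₀)) := by
    refine analytic_and_bounded_locE_param_of_expLinear D G (termHistExpLinear_termAt 𝔊 hroom hm hN hq) hg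
      (isOpen_ball.prod isOpen_ball) hcurve hK hR hscale hact (fun Z i => (𝔊 k i (emb Z)).N₁_nonneg)
      (fun Z i _ => Filter.Eventually.of_forall fun z => (𝔊 k i (emb Z)).norm_readOut_le z.1 z.2)
      hA hr₁ hb hrate hsmall (fun Z hZ => le_trans ?_ (hM3 Z hZ))
    refine Finset.sum_le_sum fun i _ => mul_le_mul_of_nonneg_right ?_ (Real.exp_pos _).le
    simpa only [one_mul] using norm_integral_coreDensity_le (𝔊 k i (emb Z)) (hm k g hg U (emb Z) (hscale Z) i)
      (hN k g hg U (emb Z) (hscale Z) i).2.2 (hq k g hg U (emb Z) (hscale Z) i).2.2 ho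
  exact rebornMuDeriv_le_of_bidisc (E := fun z => locE G.ι G.cubes (act z) (G.cubes X₀)) hv hvε hjoint.1 hjoint.2 h01 hμ

end Dep

end Summit.QuantumFields.BalabanUV.T4Continuum.NE1p.DressedRebornMuResponse

end
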